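import Summits.QuantumFields.YangMills.Theses.ScalingWindowSplit
import Literature.MathematicalPhysics.QuantumFieldTheory.LatticeGaugeProofs

/-!
# Disproof of `GapAtCorrelationLength` (stmt-QuantumFields-18927; W₁ of route `ScalingWindowSplit`) — findings

Standing disprover's work file (`cdisprove`, cycle 1, 2026-08-17).  Prose only in docstrings.  INDEX:

* §1 NON-ABELIANNESS IS LOAD-BEARING.  `GapAtCorrelationLengthWithoutNonabelian` = the crux with its only ∀-side
  hypothesis `IsCompactSimpleLieGroup G` weakened to "connected ∧ linear" (`ConnectedSpace G → Nonempty (LatticeRep G)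
  →`); `gapAtCorrelationLength_false_without_nonabelian : ¬ …WithoutNonabelian` (witness: the one-element gauge group —
  every lattice observable is constant, the bare truncated two-point function `T⁰_k(u,θu)` vanishes identically, the
  polynomial FLOOR `a_k^p ≤ T⁰_k(u,θu)` fails; §1b `allButFloor_punit`: EVERY OTHER conjunct — weak coupling,
  PolyVolume, gap, RP-spectral with `C = 0`, window — holds there along `junkScheme`).  Kernel-checked,
  landing copy `Negative/GapAtCorrelationLengthFalseWithoutNonabelian.lean`; the physics-grade companions of the route
  text (finite `G`: freezing kills the floor; `U(1)`: Coulomb phase kills the gap) are not formalisable today and are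
  NOT claimed.
* §2 THE WEAKEST DISPROOF HYPOTHESIS.  `SlabCorrelationPersists G`: at every large coupling, for every rate `μ > 0`,
  on arbitrarily large odd symmetric tori some bounded time-slab functional keeps
  `⟨ΘY·τ_nY⟩ − ⟨Y⟩² ≥ e^{−μS}` across `n ≥ S/4` (subexponentially persistent slab correlation).
  `gapAtCorrelationLength_false_of_slabCorrelationPersists : IsCompactSimpleLieGroup G → SlabCorrelationPersists G →
  ¬W₁`; packaged `PersistentSlabCorrelation` (∃ admissible `G`) and
  `gapAtCorrelationLength_false_of_persistentSlabCorrelation : PersistentSlabCorrelation → ¬W₁` — the NEGATIVE LEMMA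
  MODULO H landed under `Theorems/GapAtCorrelationLength/Negative/`.  Both earlier hypotheses on this crux imply H:
  `slabCorrelationPersists_of_lightFlux` (strategist, `LightFluxObstruction.lean`: 't Hooft light flux, constant
  sector spread `δ₀`) and `slabCorrelationPersists_of_lightFluxWeak` (ideator 1, `NegationIdeator1.lean`: "no
  magnetic Meissner effect", spread `e^{−εS}` but conservation to `e^{−εS}/4`); the two are mutually incomparable and
  H sits below both, and H no longer asks `⟨ΘY·Y⟩ ≤ 1` (it follows from `|Y| ≤ 1` on the probability space).
* §3 WHY THE CRUX RESISTS AN UNCONDITIONAL KILL (docstring `resists`): for simply-connected `G` the RP-spectral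
  conjunct (b) IS the `S`-uniform full transfer-matrix gap (believed true); for `π₁(G) ≠ 0` (`SO(3)`, landed
  admissible) (b) is physics-false but H needs (1) minority-flux weight `w₋(S; β) ≥ e^{−o(S)}` on symmetric tori at
  weak coupling and (2) a Peierls/chessboard bound making the disc-repaired flux indicator almost conserved — (2) is
  elementary but a large formalisation, (1) is rigorously open (Jensen / thick-vortex variational bounds give only
  `e^{−c·area}`; RP gives only `Z_twist ≤ Z`); no exact symmetry relates the flux sectors of a centre-free group.
  Formal junk audit of the other conjuncts: none (RP holds for ALL bounded slab `Y`, gauge-variant or not, by Haar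
  averaging of the positive-type crossing kernel; thermal term consistent by PolyVolume; `T₀ = 0` ⇒ `Y` constant;
  `B ≥ 0` forced; non-Hausdorff / finite `G` excluded by `IsCompactSimpleLieGroup`).
* CLASS (for the planner): refuted-MISSTATED modulo H — the witness family is a spatially GLOBAL slab functional;
  repaired statement `C′` = the crux with `DependsOn Y {slab}` replaced by `DependsOn Y (Strategist.slabBox T₀ R) ∧
  R < S₀` (R1, typed in `LightFluxObstruction.lean` Part B) or by the local gauge-invariant algebra (R2, census §1);
  the witness misses `C′` (contractible support cannot see `H²(T³; π₁G)` flux; near-global box functionals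
  decorrelate fast, ideator F6).
-/

noncomputable section

open scoped BigOperators Topology
open MeasureTheory Filter Set Function
open Literature.MathematicalPhysics.QuantumLattice Literature.MathematicalPhysics.AQFT
open Literature.MathematicalPhysics.QuantumFieldTheory

namespace Summit.QuantumFields.YangMills.Cruxes.GapAtCorrelationLength.Disproof

open Summit.QuantumFields.YangMills.Theses.ScalingWindowSplit (GapAtCorrelationLength)

/-! ## §1 The ∀-hypothesis `IsCompactSimpleLieGroup G` is load-bearing -/

/-- **The crux with `IsCompactSimpleLieGroup G` WEAKENED to "connected and linear"** (`ConnectedSpace G → Nonempty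
(LatticeRep G) →` replaces `IsCompactSimpleLieGroup G →`: exactly non-abelianness / simplicity dropped; everything else
verbatim). [folklore] -/
def GapAtCorrelationLengthWithoutNonabelian : Prop :=
  let E := EuclideanSpace ℝ (Fin 4); ∀ (G : Type) [Group G] [TopologicalSpace G] [IsTopologicalGroup G] [CompactSpace G], ConnectedSpace G → Nonempty (LatticeRep G) → letI : MeasurableSpace G := borel G; haveI : BorelSpace G := ⟨rfl⟩; ∃ (r : LatticeRep G) (sch : SpeciesScheme (YMSpecies G)) (u : SchwartzMap E ℝ) (p : ℕ) (M Δ C : ℝ), let bare : SpeciesScheme (YMSpecies G) := { sch with c := fun _ _ => 1, m := fun _ _ => 0 }; let T : SchwartzMap E ℝ → ℕ → ℝ := fun w k => latticeSchwinger r.ρ bare (fun s => s.F) k (1 + 1) (fun _ => r.curvature) ![w, thetaTest 4 w] - latticeSchwinger r.ρ bare (fun s => s.F) k 1 (fun _ => r.curvature) ![w] * latticeSchwinger r.ρ bare (fun s => s.F) k 1 (fun _ => r.curvature) ![thetaTest 4 w]; sch.HasWeakCouplingLimit ∧ (∃ N : ℕ, 1 ≤ N ∧ ∀ᶠ k in Filter.atTop,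 (sch.a k)⁻¹ ≤ (sch.a k * (sch.L k : ℝ)) ^ N) ∧ 0 < Δ ∧ HasLatticeMassGap r sch Δ ∧ (∀ᶠ k in Filter.atTop, ∀ (S₀ T₀ n : ℕ), sch.L k ≤ S₀ → 2 * (T₀ + n + 1) ≤ S₀ → ∀ (Y : LGConfig 4 G → ℝ) (B : ℝ), Measurable Y → (∀ U, |Y U| ≤ B) → DependsOn Y {e : Literature.MathematicalPhysics.QuantumLattice.ZdEdge 4 | 1 ≤ e.1 0 ∧ e.1 0 + (if e.2 = 0 then 1 else 0) ≤ T₀} → |(∫ U, Y (torusLift (2 * S₀ + 1) (GaugeConfig.timeReflect U)) * Y (configShift (-Pi.single 0 (n : ℤ)) (torusLift (2 * S₀ + 1) U)) ∂(wilsonMeasure r.ρ (sch.β k) : Measure (GaugeConfig 4 (2 * S₀ + 1) G))) - (∫ U, Y (torusLift (2 * S₀ + 1) U) ∂(wilsonMeasure r.ρ (sch.β k) : Measure (GaugeConfig 4 (2 * S₀ + 1) G))) ^ 2| ≤ Real.exp (-(Δ * sch.a k * n)) * ((∫ U, Y (torusLift (2 * S₀ + 1) (GaugeConfig.timeReflect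 U)) * Y (torusLift (2 * S₀ + 1) U) ∂(wilsonMeasure r.ρ (sch.β k) : Measure (GaugeConfig 4 (2 * S₀ + 1) G))) - (∫ U, Y (torusLift (2 * S₀ + 1) U) ∂(wilsonMeasure r.ρ (sch.β k) : Measure (GaugeConfig 4 (2 * S₀ + 1) G))) ^ 2) + C * B ^ 2 * Real.exp (-(Δ * sch.a k * S₀))) ∧ tsupport u ⊆ {y : E | y 0 < 0} ∧ ∀ᶠ k in Filter.atTop, (sch.a k) ^ p ≤ T u k ∧ T u k ≤ M * T (timeShiftTest 4 (-1) u) k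

/-- On a one-point probability space every real integral is evaluation at the point. [folklore] -/
theorem integral_eq_apply_default {Ω : Type*} [MeasurableSpace Ω] [Unique Ω] (μ : Measure Ω)
    [IsProbabilityMeasure μ] (f : Ω → ℝ) : ∫ x, f x ∂μ = f default :=
  integral_eq_const (Eventually.of_forall fun x => congrArg f (Subsingleton.elim x default))

/-- **At a one-element gauge group every lattice Schwinger function is the value of the integrand at the unique
configuration** (Wilson's measure is a probability measure for the continuous `r.ρ`). [folklore] -/
theorem latticeSchwinger_of_subsingleton {G : Type} [Group G] [TopologicalSpace G] [IsTopologicalGroup G]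
    [CompactSpace G] [MeasurableSpace G] [BorelSpace G] [Subsingleton G] (r : LatticeRep G)
    (S : SpeciesScheme (YMSpecies G)) (k n : ℕ) (σ : Fin n → YMSpecies G)
    (f : Fin n → SchwartzMap (EuclideanSpace ℝ (Fin 4)) ℝ) (U₀ : GaugeConfig 4 (S.side k) G) :
    latticeSchwinger r.ρ S (fun s => s.F) k n σ f =
      ∏ i, smearedLatticeField (σ i).F (Literature.Probability.LatticeModels.box 4 (S.L k)) (S.a k)
        (S.c (σ i) k) (S.m (σ i) k) (f i) (torusLift (S.side k) U₀) := by
  haveI := isProbabilityMeasure_wilsonMeasure (d := 4) (L := S.side k) r.ρ r.continuous (S.β k)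
  haveI : Unique (GaugeConfig 4 (S.side k) G) := ⟨⟨U₀⟩, fun V => Subsingleton.elim _ _⟩
  unfold latticeSchwinger
  rw [integral_eq_apply_default, Subsingleton.elim (default : GaugeConfig 4 (S.side k) G) U₀]

/-- **Non-abelianness (simplicity) is load-bearing: the crux with `IsCompactSimpleLieGroup G` weakened to "compact,
connected, linear" is FALSE** (witness `G = PUnit`, connected, faithful continuous unitary `ρ ≡ 1` on `ℂ¹`): all
configurations coincide, so the bare truncated reflected two-point function of the curvature is `Φ(u)Φ(θu) −
Φ(u)Φ(θu) = 0` at every step, and the floor `a_k^p ≤ 0` contradicts `a_k > 0`.  Any proof of W₁ must use that `G`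
has two non-commuting elements (in the tree: faithfulness of `r` + a non-commuting pair give a positive plaquette
variance, `Cruxes/BrascampLiebVacuumSC/Disproof.lean` `plaquette_variance_floor`).  LANDING copy:
`Theorems/GapAtCorrelationLength/Negative/GapAtCorrelationLengthFalseWithoutNonabelian.lean`. [folklore] -/
theorem gapAtCorrelationLength_false_without_nonabelian : ¬ GapAtCorrelationLengthWithoutNonabelian := by
  intro h
  letI : MeasurableSpace PUnit.{1} := borel PUnit
  haveI : BorelSpace PUnit.{1} := ⟨rfl⟩
  obtain ⟨r, sch, u, p, M, Δ, C, -, -, -, -, -, -, hfw⟩ :=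
    h PUnit inferInstance ⟨⟨1, 1, continuous_const, fun a b _ => Subsingleton.elim a b, fun _ => by simp⟩⟩
  obtain ⟨k, hfloor, -⟩ := hfw.exists
  -- the bare scheme and the unique configuration
  set bare : SpeciesScheme (YMSpecies PUnit.{1}) := { sch with c := fun _ _ => 1, m := fun _ _ => 0 } with hbare
  have hT : ∀ (n : ℕ) (σ : Fin n → YMSpecies PUnit.{1}) (f : Fin n → SchwartzMap (EuclideanSpace ℝ (Fin 4)) ℝ),
      latticeSchwinger r.ρ bare (fun s => s.F) k n σ f =
        ∏ i, smearedLatticeField (σ i).F (Literature.Probability.LatticeModels.box 4 (bare.L k)) (bare.a k)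
          (bare.c (σ i) k) (bare.m (σ i) k) (f i) (torusLift (bare.side k) default) :=
    fun n σ f => latticeSchwinger_of_subsingleton r bare k n σ f default
  have h2 := hT (1 + 1) (fun _ => r.curvature) ![u, thetaTest 4 u]
  have h1 := hT 1 (fun _ => r.curvature) ![u]
  have h1' := hT 1 (fun _ => r.curvature) ![thetaTest 4 u]
  rw [Fin.prod_univ_two] at h2
  rw [Fin.prod_univ_one] at h1 h1'
  simp only [Matrix.cons_val_zero, Matrix.cons_val_one] at h2 h1 h1'
  have hzero : latticeSchwinger r.ρ bare (fun s => s.F) k (1 + 1) (fun _ => r.curvature) ![u, thetaTest 4 u] -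
      latticeSchwinger r.ρ bare (fun s => s.F) k 1 (fun _ => r.curvature) ![u] *
        latticeSchwinger r.ρ bare (fun s => s.F) k 1 (fun _ => r.curvature) ![thetaTest 4 u] = 0 := by
    rw [h2, h1, h1']; ring
  have hpos : 0 < sch.a k ^ p := pow_pos (sch.a_pos k) p
  have hle : sch.a k ^ p ≤ 0 := by simpa [hbare] using hfloor.trans_eq hzero
  exact absurd hle (not_le.2 hpos)

/-! ### §1b At the trivial group EVERY conjunct except the floor is junk-satisfiable

So the polynomial floor `a_k^p ≤ T⁰_k(u,θu)` is the ONLY conjunct of W₁ through which non-triviality of `G` enters: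
weak coupling, polynomial volumes, `HasLatticeMassGap`, the RP-spectral conjunct (with `C = 0`), past support and
the window are all inhabited at `G = PUnit` by the explicit scheme `a_k = 1/(k+1)`, `β_k = k`, `L_k = (k+1)²`. -/

/-- The junk scheme at the trivial group: `a_k = 1/(k+1)`, `β_k = k` (weak coupling), `L_k = (k+1)²`, `c = m ≡ 0`.
[folklore] -/
def junkScheme : SpeciesScheme (YMSpecies PUnit.{1}) where
  a := fun k => ((k : ℝ) + 1)⁻¹
  a_pos := fun k => by positivity
  tendsto_a := tendsto_inv_atTop_zero.comp (tendsto_natCast_atTop_atTop.atTop_add tendsto_const_nhds)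
  β := fun k => k
  L := fun k => (k + 1) ^ 2
  tendsto_L := by
    have h : (fun k : ℕ => ((k : ℝ) + 1)⁻¹ * (((k + 1) ^ 2 : ℕ) : ℝ)) = fun k : ℕ => (k : ℝ) + 1 := by
      funext k; push_cast; field_simp
    rw [h]
    exact tendsto_natCast_atTop_atTop.atTop_add tendsto_const_nhds
  c := fun _ _ => 0
  m := fun _ _ => 0

/-- All `ℤ⁴`-configurations with values in `PUnit` coincide. [folklore] -/
theorem lgConfig_punit_eq (U V : LGConfig 4 PUnit.{1}) : U = V := Subsingleton.elim U V

/-- **Every conjunct of W₁ but the floor holds at `G = PUnit`** along `junkScheme`, for every representation `r`,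
every real test `u` and every `M`: weak coupling (`β_k = k → ∞`), PolyVolume (`N = 1`: `a_k⁻¹ = k+1 = a_k L_k`), the
volume-uniform gap for every `Δ` (all connected correlations vanish, constant `0`), the RP-spectral conjunct for every
`Δ` with `C = 0` (both sides vanish), and the window (`0 ≤ M · 0`); while the FLOOR FAILS at every step and every
exponent.  [folklore] -/
theorem allButFloor_punit :
    letI : MeasurableSpace PUnit.{1} := borel PUnit
    haveI : BorelSpace PUnit.{1} := ⟨rfl⟩
    ∀ (r : LatticeRep PUnit.{1}) (u : SchwartzMap (EuclideanSpace ℝ (Fin 4)) ℝ) (M Δ : ℝ),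
    let sch := junkScheme
    let bare : SpeciesScheme (YMSpecies PUnit.{1}) := { sch with c := fun _ _ => 1, m := fun _ _ => 0 }
    let T : SchwartzMap (EuclideanSpace ℝ (Fin 4)) ℝ → ℕ → ℝ := fun w k =>
      latticeSchwinger r.ρ bare (fun s => s.F) k (1 + 1) (fun _ => r.curvature) ![w, thetaTest 4 w] -
        latticeSchwinger r.ρ bare (fun s => s.F) k 1 (fun _ => r.curvature) ![w] *
          latticeSchwinger r.ρ bare (fun s => s.F) k 1 (fun _ => r.curvature) ![thetaTest 4 w]
    sch.HasWeakCouplingLimit ∧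
    (∃ N : ℕ, 1 ≤ N ∧ ∀ᶠ k in Filter.atTop, (sch.a k)⁻¹ ≤ (sch.a k * (sch.L k : ℝ)) ^ N) ∧
    HasLatticeMassGap r sch Δ ∧
    (∀ (k S₀ T₀ n : ℕ) (Y : LGConfig 4 PUnit.{1} → ℝ) (B : ℝ),
      |(∫ U, Y (torusLift (2 * S₀ + 1) (GaugeConfig.timeReflect U)) *
            Y (configShift (-Pi.single 0 (n : ℤ)) (torusLift (2 * S₀ + 1) U))
          ∂(wilsonMeasure r.ρ (sch.β k) : Measure (GaugeConfig 4 (2 * S₀ + 1) PUnit.{1}))) -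
        (∫ U, Y (torusLift (2 * S₀ + 1) U)
          ∂(wilsonMeasure r.ρ (sch.β k) : Measure (GaugeConfig 4 (2 * S₀ + 1) PUnit.{1}))) ^ 2| ≤
      Real.exp (-(Δ * sch.a k * n)) *
        ((∫ U, Y (torusLift (2 * S₀ + 1) (GaugeConfig.timeReflect U)) * Y (torusLift (2 * S₀ + 1) U)
            ∂(wilsonMeasure r.ρ (sch.β k) : Measure (GaugeConfig 4 (2 * S₀ + 1) PUnit.{1}))) -
          (∫ U, Y (torusLift (2 * S₀ + 1) U)
            ∂(wilsonMeasure r.ρ (sch.β k) : Measure (GaugeConfig 4 (2 * S₀ + 1) PUnit.{1}))) ^ 2) +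
      0 * B ^ 2 * Real.exp (-(Δ * sch.a k * S₀))) ∧
    (∀ k, T u k ≤ M * T (timeShiftTest 4 (-1) u) k) ∧
    (∀ (k p : ℕ), ¬ (sch.a k) ^ p ≤ T u k) := by
  letI : MeasurableSpace PUnit.{1} := borel PUnit
  haveI : BorelSpace PUnit.{1} := ⟨rfl⟩
  intro r u M Δ sch bare T
  -- the bare truncated two-point function vanishes identically
  have hT0 : ∀ (w : SchwartzMap (EuclideanSpace ℝ (Fin 4)) ℝ) (k : ℕ), T w k = 0 := by
    intro w k
    have hS : ∀ (n : ℕ) (σ : Fin n → YMSpecies PUnit.{1}) (f : Fin n → SchwartzMap (EuclideanSpace ℝ (Fin 4)) ℝ),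
        latticeSchwinger r.ρ bare (fun s => s.F) k n σ f =
          ∏ i, smearedLatticeField (σ i).F (Literature.Probability.LatticeModels.box 4 (bare.L k)) (bare.a k)
            (bare.c (σ i) k) (bare.m (σ i) k) (f i) (torusLift (bare.side k) default) :=
      fun n σ f => latticeSchwinger_of_subsingleton r bare k n σ f default
    have h2 := hS (1 + 1) (fun _ => r.curvature) ![w, thetaTest 4 w]
    have h1 := hS 1 (fun _ => r.curvature) ![w]
    have h1' := hS 1 (fun _ => r.curvature) ![thetaTest 4 w]
    rw [Fin.prod_univ_two] at h2
    rw [Fin.prod_univ_one] at h1 h1'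
    simp only [Matrix.cons_val_zero, Matrix.cons_val_one] at h2 h1 h1'
    show latticeSchwinger r.ρ bare (fun s => s.F) k (1 + 1) (fun _ => r.curvature) ![w, thetaTest 4 w] -
        latticeSchwinger r.ρ bare (fun s => s.F) k 1 (fun _ => r.curvature) ![w] *
          latticeSchwinger r.ρ bare (fun s => s.F) k 1 (fun _ => r.curvature) ![thetaTest 4 w] = 0
    rw [h2, h1, h1']; ring
  refine ⟨?_, ⟨1, le_rfl, Eventually.of_forall fun k => ?_⟩, ?_, ?_, ?_, ?_⟩
  · -- weak coupling: β_k = k → ∞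
    exact tendsto_natCast_atTop_atTop
  · -- PolyVolume with N = 1
    show (((k : ℝ) + 1)⁻¹)⁻¹ ≤ (((k : ℝ) + 1)⁻¹ * (((k + 1) ^ 2 : ℕ) : ℝ)) ^ 1
    have hk : (0 : ℝ) < (k : ℝ) + 1 := by positivity
    rw [inv_inv, pow_one]
    push_cast
    rw [show ((k : ℝ) + 1)⁻¹ * ((k : ℝ) + 1) ^ 2 = (k : ℝ) + 1 by field_simp]
  · -- volume-uniform gap: all connected correlations vanish
    intro A B
    refine ⟨0, Eventually.of_forall fun k S _ n _ => ?_⟩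
    haveI := isProbabilityMeasure_wilsonMeasure (d := 4) (L := 2 * S + 1) r.ρ r.continuous (sch.β k)
    have : latticeConnectedCorr r.ρ (sch.β k) (2 * S + 1) A.F B.F n = 0 := by
      unfold latticeConnectedCorr
      rw [integral_eq_apply_default, integral_eq_apply_default, integral_eq_apply_default,
        lgConfig_punit_eq (configShift _ (torusLift (2 * S + 1) default)) (torusLift (2 * S + 1) default)]
      ring
    rw [this, abs_zero, zero_mul]
  · -- RP-spectral conjunct with C = 0: both sides vanish
    intro k S₀ T₀ n Y B
    haveI := isProbabilityMeasure_wilsonMeasure (d := 4) (L := 2 * S₀ + 1) r.ρ r.continuous (sch.β k)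
    rw [integral_eq_apply_default, integral_eq_apply_default, integral_eq_apply_default,
      lgConfig_punit_eq (configShift _ (torusLift (2 * S₀ + 1) default)) (torusLift (2 * S₀ + 1) default),
      lgConfig_punit_eq (torusLift (2 * S₀ + 1) (GaugeConfig.timeReflect default)) (torusLift (2 * S₀ + 1) default)]
    have key : ∀ (A e e' : ℝ), |A * A - A ^ 2| ≤ e * (A * A - A ^ 2) + 0 * B ^ 2 * e' := by
      intro A e e'
      have hA : A * A - A ^ 2 = 0 := by ring
      rw [hA]; simp
    exact key _ _ _
  · -- window: 0 ≤ M · 0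
    intro k
    rw [hT0, hT0, mul_zero]
  · -- the floor fails at every step and exponent
    intro k p hfloor
    rw [hT0] at hfloor
    exact absurd hfloor (not_le.2 (pow_pos (sch.a_pos k) p))

/-! ## §2 The weakest disproof hypothesis: subexponentially persistent slab correlation -/

/-- **`SlabCorrelationPersists G`** (per-group body of the hypothesis `H`).  For every faithful lattice
representation `r` there is `β₀` such that at every coupling `β ≥ β₀`, for every rate `μ > 0` and beyond every size
`M₀`, some odd symmetric torus `(2S+1)⁴`, slab width `T`, separation `n` with `2(T+n+1) ≤ S ≤ 4n` and some measurable
slab functional `Y`, `|Y| ≤ 1`, depending on the edges of the time slab `[1, T]`, keep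
`e^{−μS} ≤ ⟨ΘY · τ_nY⟩_{β,2S+1} − ⟨Y⟩²_{β,2S+1}` (integrals verbatim as in the crux's RP-spectral conjunct).
Physically, for `G = SO(3)`: the disc-repaired `ℤ₂` magnetic-flux indicator through a spatial 2-torus, whose
minority sector has weight `≥ e^{−o(S)}` (no magnetic Meissner effect) and which is almost conserved in Euclidean time
(dilute `ℤ₂`-monopole clusters).  Weaker than `Strategist.LightFlux` and than `Ideator1.LightFluxWeak` (verbatim copies `LightFlux`, `LightFluxWeak` below)
(`slabCorrelationPersists_of_lightFlux`, `slabCorrelationPersists_of_lightFluxWeak`). [folklore] -/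
def SlabCorrelationPersists (G : Type) [Group G] [TopologicalSpace G] [IsTopologicalGroup G] [CompactSpace G] :
    Prop :=
  letI : MeasurableSpace G := borel G
  haveI : BorelSpace G := ⟨rfl⟩
  ∀ (r : LatticeRep G), ∃ β₀ : ℝ, ∀ β : ℝ, β₀ ≤ β → ∀ μ : ℝ, 0 < μ → ∀ M₀ : ℕ,
    ∃ (S T n : ℕ), M₀ ≤ S ∧ 2 * (T + n + 1) ≤ S ∧ S ≤ 4 * n ∧
    ∃ (Y : LGConfig 4 G → ℝ), Measurable Y ∧ (∀ U, |Y U| ≤ 1) ∧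
      DependsOn Y {e : Literature.MathematicalPhysics.QuantumLattice.ZdEdge 4 |
        1 ≤ e.1 0 ∧ e.1 0 + (if e.2 = 0 then 1 else 0) ≤ T} ∧
      Real.exp (-(μ * S)) ≤
        (∫ U, Y (torusLift (2 * S + 1) (GaugeConfig.timeReflect U)) *
            Y (configShift (-Pi.single 0 (n : ℤ)) (torusLift (2 * S + 1) U))
            ∂(wilsonMeasure r.ρ β : Measure (GaugeConfig 4 (2 * S + 1) G))) -
        (∫ U, Y (torusLift (2 * S + 1) U)
            ∂(wilsonMeasure r.ρ β : Measure (GaugeConfig 4 (2 * S + 1) G))) ^ 2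

/-- **`H` packaged**: some ADMISSIBLE gauge group (compact simple Lie) has subexponentially persistent slab
correlation at weak coupling.  Expected inhabitant: `G = SO(3)` (admissible: `isCompactSimpleLieGroup_SO3`, landed in
`Theorems/ConvexGribovBodyNonSimplyConnectedLatticeGapAdmissibleInstance.lean`); not constructible in the tree today
(§3). [folklore] -/
def PersistentSlabCorrelation : Prop :=
  ∃ (G : Type) (_ : Group G) (_ : TopologicalSpace G) (_ : IsTopologicalGroup G) (_ : CompactSpace G),
    IsCompactSimpleLieGroup G ∧ SlabCorrelationPersists G

/-- **Negative lemma, per-group form: `IsCompactSimpleLieGroup G → SlabCorrelationPersists G → ¬W₁`.**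
Bookkeeping: W₁ at `G` gives `(r, sch, Δ, C)` with the RP-spectral conjunct eventually in `k`; pick `k` with the
conjunct active and `β_k ≥ β₀`; put `μ := Δ a_k / 8` and take the witness `(S, T, n, Y)` of `H` beyond
`max N₀ L_k`; the conjunct at `(S, T, n, Y, B = 1)` gives `e^{−μS} ≤ I_n − ⟨Y⟩² ≤ e^{−Δa_k n}(I_0 − ⟨Y⟩²) + C e^{−Δa_k S}
≤ e^{−2μS} + |C| e^{−8μS} < e^{−μS}` for `S ≥ N₀` (`I_0 ≤ 1` because `|Y| ≤ 1` and Wilson's measure is a probability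
measure). [folklore] -/
theorem gapAtCorrelationLength_false_of_slabCorrelationPersists
    (G : Type) [Group G] [TopologicalSpace G] [IsTopologicalGroup G] [CompactSpace G]
    (hG : IsCompactSimpleLieGroup G) (hH : SlabCorrelationPersists G) :
    ¬ GapAtCorrelationLength := by
  intro hW
  letI : MeasurableSpace G := borel G
  haveI : BorelSpace G := ⟨rfl⟩
  obtain ⟨r, sch, u, p, M, Δ, C, hweak, -, hΔ, -, hRP, -, -⟩ := hW G hG
  obtain ⟨β₀, hβ₀⟩ := hH r
  obtain ⟨k, hRPk, hβk⟩ := (hRP.and (hweak.eventually_ge_atTop β₀)).exists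
  have ha : 0 < sch.a k := sch.a_pos k
  have hΔa : 0 < Δ * sch.a k := mul_pos hΔ ha
  set μ : ℝ := Δ * sch.a k / 8 with hμ_def
  have hμ : 0 < μ := by positivity
  -- h(S) := e^{-μS} + |C| e^{-7μS} → 0; beyond N₀ it is < 1
  set h : ℝ → ℝ := fun x => Real.exp (-(μ * x)) + |C| * Real.exp (-(7 * μ * x)) with hh_def
  have hh : Tendsto h atTop (𝓝 0) := by
    have t1 : Tendsto (fun x : ℝ => μ * x) atTop atTop := tendsto_id.const_mul_atTop hμ
    have t7 : Tendsto (fun x : ℝ => 7 * μ * x) atTop atTop :=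
      tendsto_id.const_mul_atTop (by positivity : (0:ℝ) < 7 * μ)
    have e1 : Tendsto (fun x : ℝ => Real.exp (-(μ * x))) atTop (𝓝 0) :=
      Real.tendsto_exp_atBot.comp (tendsto_neg_atTop_atBot.comp t1)
    have e2 : Tendsto (fun x : ℝ => |C| * Real.exp (-(7 * μ * x))) atTop (𝓝 (|C| * 0)) :=
      (Real.tendsto_exp_atBot.comp (tendsto_neg_atTop_atBot.comp t7)).const_mul |C|
    simpa [hh_def] using e1.add e2
  have hhN : Tendsto (fun S : ℕ => h S) atTop (𝓝 0) := hh.comp tendsto_natCast_atTop_atTop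
  obtain ⟨N₀, hN₀⟩ := eventually_atTop.1 (hhN.eventually (gt_mem_nhds (by norm_num : (0:ℝ) < 1)))
  obtain ⟨S, T, n, hMS, h2, h4, Y, hYm, hYb, hYdep, hlow⟩ := hβ₀ (sch.β k) hβk μ hμ (max N₀ (sch.L k))
  have hLS : sch.L k ≤ S := (le_max_right _ _).trans hMS
  have hNS : N₀ ≤ S := (le_max_left _ _).trans hMS
  have key := hRPk S T n hLS h2 Y 1 hYm hYb hYdep
  -- `I_0 ≤ 1` from `|Y| ≤ 1` on the probability space
  haveI := isProbabilityMeasure_wilsonMeasure (d := 4) (L := 2 * S + 1) r.ρ r.continuous (sch.β k)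
  have hI0 : (∫ U, Y (torusLift (2 * S + 1) (GaugeConfig.timeReflect U)) * Y (torusLift (2 * S + 1) U)
      ∂(wilsonMeasure r.ρ (sch.β k) : Measure (GaugeConfig 4 (2 * S + 1) G))) ≤ 1 := by
    have hb : ∀ U : GaugeConfig 4 (2 * S + 1) G,
        ‖Y (torusLift (2 * S + 1) (GaugeConfig.timeReflect U)) * Y (torusLift (2 * S + 1) U)‖ ≤ 1 := by
      intro U
      rw [Real.norm_eq_abs, abs_mul]
      have h₁ := hYb (torusLift (2 * S + 1) (GaugeConfig.timeReflect U))
      have h₂ := hYb (torusLift (2 * S + 1) U)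
      nlinarith [abs_nonneg (Y (torusLift (2 * S + 1) (GaugeConfig.timeReflect U))),
        abs_nonneg (Y (torusLift (2 * S + 1) U))]
    have := norm_integral_le_of_norm_le_const
      (μ := (wilsonMeasure r.ρ (sch.β k) : Measure (GaugeConfig 4 (2 * S + 1) G))) (Eventually.of_forall hb)
    rw [probReal_univ, mul_one, Real.norm_eq_abs] at this
    exact (le_abs_self _).trans this
  generalize hIn_def : (∫ U, Y (torusLift (2 * S + 1) (GaugeConfig.timeReflect U)) *
      Y (configShift (-Pi.single 0 (n : ℤ)) (torusLift (2 * S + 1) U))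
      ∂(wilsonMeasure r.ρ (sch.β k) : Measure (GaugeConfig 4 (2 * S + 1) G))) = In at key hlow
  generalize hI0_def : (∫ U, Y (torusLift (2 * S + 1) (GaugeConfig.timeReflect U)) *
      Y (torusLift (2 * S + 1) U)
      ∂(wilsonMeasure r.ρ (sch.β k) : Measure (GaugeConfig 4 (2 * S + 1) G))) = I0 at key hI0
  generalize hm_def : (∫ U, Y (torusLift (2 * S + 1) U)
      ∂(wilsonMeasure r.ρ (sch.β k) : Measure (GaugeConfig 4 (2 * S + 1) G))) = m at key hlow
  -- exponent algebra
  have hS4 : (S : ℝ) ≤ 4 * n := by exact_mod_cast h4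
  have hexp_n : Real.exp (-(Δ * sch.a k * n)) ≤ Real.exp (-(2 * μ * S)) := by
    apply Real.exp_le_exp.2
    rw [hμ_def]
    nlinarith [mul_le_mul_of_nonneg_left hS4 hΔa.le]
  have hsplit2 : Real.exp (-(2 * μ * S)) = Real.exp (-(μ * S)) * Real.exp (-(μ * S)) := by
    rw [← Real.exp_add]; ring_nf
  have hsplit8 : Real.exp (-(Δ * sch.a k * S)) = Real.exp (-(μ * S)) * Real.exp (-(7 * μ * S)) := by
    rw [← Real.exp_add, hμ_def]; ring_nf
  have hE : 0 < Real.exp (-(μ * S)) := Real.exp_pos _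
  have hexp0 : 0 ≤ Real.exp (-(Δ * sch.a k * n)) := Real.exp_nonneg _
  have hdiff : I0 - m ^ 2 ≤ 1 := by nlinarith [sq_nonneg m]
  have hup : In - m ^ 2 ≤ Real.exp (-(μ * S)) * h S := by
    have t1 : Real.exp (-(Δ * sch.a k * n)) * (I0 - m ^ 2) ≤ Real.exp (-(μ * S)) * Real.exp (-(μ * S)) := by
      calc Real.exp (-(Δ * sch.a k * n)) * (I0 - m ^ 2)
          ≤ Real.exp (-(Δ * sch.a k * n)) * 1 := mul_le_mul_of_nonneg_left hdiff hexp0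
        _ ≤ Real.exp (-(2 * μ * S)) := by simpa using hexp_n
        _ = _ := hsplit2
    have t2 : C * (1 : ℝ) ^ 2 * Real.exp (-(Δ * sch.a k * S)) ≤
        Real.exp (-(μ * S)) * (|C| * Real.exp (-(7 * μ * S))) := by
      rw [hsplit8]
      have hC := le_abs_self C
      have hE7 : 0 ≤ Real.exp (-(7 * μ * S)) := Real.exp_nonneg _
      nlinarith [mul_nonneg hE.le hE7]
    have hlhs : In - m ^ 2 ≤ |In - m ^ 2| := le_abs_self _
    have : In - m ^ 2 ≤ Real.exp (-(μ * S)) * Real.exp (-(μ * S)) +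
        Real.exp (-(μ * S)) * (|C| * Real.exp (-(7 * μ * S))) := by linarith
    simpa [hh_def, mul_add] using this
  have hhS : h S < 1 := hN₀ S hNS
  have : Real.exp (-(μ * S)) * h S < Real.exp (-(μ * S)) * 1 := mul_lt_mul_of_pos_left hhS hE
  linarith

/-- **Negative lemma modulo `H` (packaged): `PersistentSlabCorrelation → ¬ GapAtCorrelationLength`.** [folklore] -/
theorem gapAtCorrelationLength_false_of_persistentSlabCorrelation :
    PersistentSlabCorrelation → ¬ GapAtCorrelationLength := by
  rintro ⟨G, _, _, _, _, hG, hH⟩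
  exact gapAtCorrelationLength_false_of_slabCorrelationPersists G hG hH

/-- **VERBATIM COPY of the strategist's `Strategist.LightFlux`** (`Cruxes/GapAtCorrelationLength/LightFluxObstruction.lean`
Part A; copied because crux work files are not built on the farm, so this work file cannot import them): light,
almost-conserved flux functional with a CONSTANT sector spread `δ₀` and conservation to `δ₀/4`. [folklore] -/
def LightFlux (G : Type) [Group G] [TopologicalSpace G] [IsTopologicalGroup G] [CompactSpace G] : Prop :=
  letI : MeasurableSpace G := borel G
  haveI : BorelSpace G := ⟨rfl⟩
  ∀ (r : LatticeRep G), ∃ β₀ : ℝ, ∀ β : ℝ, β₀ ≤ β → ∃ δ₀ : ℝ, 0 < δ₀ ∧ ∀ M₀ : ℕ,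
    ∃ (S T n : ℕ), M₀ ≤ S ∧ 2 * (T + n + 1) ≤ S ∧ S ≤ 4 * n ∧
    ∃ (Y : LGConfig 4 G → ℝ), Measurable Y ∧ (∀ U, |Y U| ≤ 1) ∧
      DependsOn Y {e : Literature.MathematicalPhysics.QuantumLattice.ZdEdge 4 |
        1 ≤ e.1 0 ∧ e.1 0 + (if e.2 = 0 then 1 else 0) ≤ T} ∧
      (∫ U, Y (torusLift (2 * S + 1) (GaugeConfig.timeReflect U)) * Y (torusLift (2 * S + 1) U)
          ∂(wilsonMeasure r.ρ β : Measure (GaugeConfig 4 (2 * S + 1) G))) ≤ 1 ∧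
      1 - δ₀ / 4 ≤ (∫ U, Y (torusLift (2 * S + 1) (GaugeConfig.timeReflect U)) *
          Y (configShift (-Pi.single 0 (n : ℤ)) (torusLift (2 * S + 1) U))
          ∂(wilsonMeasure r.ρ β : Measure (GaugeConfig 4 (2 * S + 1) G))) ∧
      (∫ U, Y (torusLift (2 * S + 1) U)
          ∂(wilsonMeasure r.ρ β : Measure (GaugeConfig 4 (2 * S + 1) G))) ^ 2 ≤ 1 - δ₀

/-- **VERBATIM COPY of ideator 1's `Ideator1.LightFluxWeak`** (`Cruxes/GapAtCorrelationLength/NegationIdeator1.lean`):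
sector spread weakened to `e^{−εS}` for every rate `ε > 0` chosen after the coupling, conservation strengthened to
`e^{−εS}/4` ("no magnetic Meissner effect"). Incomparable with `LightFlux`. [folklore] -/
def LightFluxWeak (G : Type) [Group G] [TopologicalSpace G] [IsTopologicalGroup G] [CompactSpace G] : Prop :=
  letI : MeasurableSpace G := borel G
  haveI : BorelSpace G := ⟨rfl⟩
  ∀ (r : LatticeRep G), ∃ β₀ : ℝ, ∀ β : ℝ, β₀ ≤ β → ∀ ε : ℝ, 0 < ε → ∀ M₀ : ℕ,
    ∃ (S T n : ℕ), M₀ ≤ S ∧ 2 * (T + n + 1) ≤ S ∧ S ≤ 4 * n ∧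
    ∃ (Y : LGConfig 4 G → ℝ), Measurable Y ∧ (∀ U, |Y U| ≤ 1) ∧
      DependsOn Y {e : Literature.MathematicalPhysics.QuantumLattice.ZdEdge 4 |
        1 ≤ e.1 0 ∧ e.1 0 + (if e.2 = 0 then 1 else 0) ≤ T} ∧
      (∫ U, Y (torusLift (2 * S + 1) (GaugeConfig.timeReflect U)) * Y (torusLift (2 * S + 1) U)
          ∂(wilsonMeasure r.ρ β : Measure (GaugeConfig 4 (2 * S + 1) G))) ≤ 1 ∧
      1 - Real.exp (-(ε * S)) / 4 ≤ (∫ U, Y (torusLift (2 * S + 1) (GaugeConfig.timeReflect U)) *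
          Y (configShift (-Pi.single 0 (n : ℤ)) (torusLift (2 * S + 1) U))
          ∂(wilsonMeasure r.ρ β : Measure (GaugeConfig 4 (2 * S + 1) G))) ∧
      (∫ U, Y (torusLift (2 * S + 1) U)
          ∂(wilsonMeasure r.ρ β : Measure (GaugeConfig 4 (2 * S + 1) G))) ^ 2 ≤ 1 - Real.exp (-(ε * S))

/-- **The strategist's `LightFlux` implies `H`**: a constant sector spread `δ₀` and conservation to `δ₀/4` give
`I_n − ⟨Y⟩² ≥ 3δ₀/4 ≥ e^{−μS}` once `S ≥ μ⁻¹ log(4/(3δ₀))`. [folklore] -/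
theorem slabCorrelationPersists_of_lightFlux
    (G : Type) [Group G] [TopologicalSpace G] [IsTopologicalGroup G] [CompactSpace G]
    (hL : LightFlux G) : SlabCorrelationPersists G := by
  intro r
  obtain ⟨β₀, hβ₀⟩ := hL r
  refine ⟨β₀, fun β hβ μ hμ M₀ => ?_⟩
  obtain ⟨δ₀, hδ₀, hM⟩ := hβ₀ β hβ
  -- beyond N₁, e^{-μS} ≤ 3δ₀/4
  have hlim : Tendsto (fun S : ℕ => Real.exp (-(μ * S))) atTop (𝓝 0) :=
    (Real.tendsto_exp_atBot.comp (tendsto_neg_atTop_atBot.comp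
      (tendsto_id.const_mul_atTop hμ))).comp tendsto_natCast_atTop_atTop
  have h34 : (0 : ℝ) < 3 * δ₀ / 4 := by positivity
  obtain ⟨N₁, hN₁⟩ := eventually_atTop.1 (hlim.eventually (gt_mem_nhds h34))
  obtain ⟨S, T, n, hMS, h2, h4, Y, hYm, hYb, hYdep, -, hIn, hm⟩ := hM (max N₁ M₀)
  refine ⟨S, T, n, (le_max_right _ _).trans hMS, h2, h4, Y, hYm, hYb, hYdep, ?_⟩
  have hS : Real.exp (-(μ * S)) < 3 * δ₀ / 4 := hN₁ S ((le_max_left _ _).trans hMS)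
  linarith

/-- **Ideator 1's `LightFluxWeak` implies `H`**: with `ε := μ/2`, spread `e^{−εS}` and conservation to `e^{−εS}/4`
give `I_n − ⟨Y⟩² ≥ (3/4)e^{−μS/2} ≥ e^{−μS}` once `e^{−μS/2} ≤ 3/4`. [folklore] -/
theorem slabCorrelationPersists_of_lightFluxWeak
    (G : Type) [Group G] [TopologicalSpace G] [IsTopologicalGroup G] [CompactSpace G]
    (hL : LightFluxWeak G) : SlabCorrelationPersists G := by
  intro r
  obtain ⟨β₀, hβ₀⟩ := hL r
  refine ⟨β₀, fun β hβ μ hμ M₀ => ?_⟩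
  have hε : 0 < μ / 2 := by positivity
  have hlim : Tendsto (fun S : ℕ => Real.exp (-(μ / 2 * S))) atTop (𝓝 0) :=
    (Real.tendsto_exp_atBot.comp (tendsto_neg_atTop_atBot.comp
      (tendsto_id.const_mul_atTop hε))).comp tendsto_natCast_atTop_atTop
  obtain ⟨N₁, hN₁⟩ := eventually_atTop.1 (hlim.eventually (gt_mem_nhds (by norm_num : (0 : ℝ) < 3 / 4)))
  obtain ⟨S, T, n, hMS, h2, h4, Y, hYm, hYb, hYdep, -, hIn, hm⟩ := hβ₀ β hβ (μ / 2) hε (max N₁ M₀)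
  refine ⟨S, T, n, (le_max_right _ _).trans hMS, h2, h4, Y, hYm, hYb, hYdep, ?_⟩
  have hS : Real.exp (-(μ / 2 * S)) < 3 / 4 := hN₁ S ((le_max_left _ _).trans hMS)
  have hsq : Real.exp (-(μ * S)) = Real.exp (-(μ / 2 * S)) * Real.exp (-(μ / 2 * S)) := by
    rw [← Real.exp_add]; ring_nf
  have hE : 0 < Real.exp (-(μ / 2 * S)) := Real.exp_pos _
  have : Real.exp (-(μ * S)) ≤ 3 / 4 * Real.exp (-(μ / 2 * S)) := by
    rw [hsq]; nlinarith
  linarith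

/-! ## §3 Why the crux resists an unconditional kill (record for the provers and the planner) -/

/-- **`resists`** (documentation anchor; the statement is `True`).

1. ADMISSIBLE `G` ARE GENUINE.  `IsCompactSimpleLieGroup G = IsSimpleCompactGroup G ∧ Nonempty (LatticeRep G)`:
   connected, non-abelian, no proper closed connected normal subgroup, and a faithful CONTINUOUS unitary matrix
   representation — the latter forces Hausdorff (so indiscrete/junk topologies are out), connectedness excludes
   finite groups, non-abelian excludes `U(1)` and `PUnit` (§1: with only "connected ∧ linear" the crux is false at `PUnit`).  So every
   admissible `G` is a compact simple Lie group and the ∃-body is Chatterjee's weak-coupling one-scale lattice gap.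
2. SIMPLY-CONNECTED `G` (`SU(N)`, `Sp(N)`, `Spin`, exceptional): the RP-spectral conjunct (b) over ALL bounded slab
   functionals is, by the transfer-matrix spectral theorem (link-plane RP near, site-plane RP far, both valid for
   gauge-VARIANT `Y` too: the crossing kernel `exp(β Re tr(A W B† W'†))` Haar-averaged over the crossing links is of
   positive type), exactly an `S`-uniform gap `≥ Δ a_k` of the FULL torus transfer matrix plus a thermal remainder
   `≲ (mP)^{3/2} e^{−mP}`, absorbed by `C e^{−Δ a_k S}` under PolyVolume.  No slow global functional exists
   (`H²(T³; π₁G) = 0`; Polyakov loops/torelons decorrelate FASTER; gauge-variant parts average out by Elitzur).  A kill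
   here = proof of a massless/deconfined weak-coupling phase: not available, believed false.
3. `π₁(G) ≠ 0` (`SO(3) = SU(2)/ℤ₂`, admissible by the landed `isCompactSimpleLieGroup_SO3`): (b) is physics-false
   (census §1; this file §2), but `SlabCorrelationPersists SO(3)` needs (1) the minority `ℤ₂`-flux sector weight
   `w₋(S; β) ≥ e^{−o(S)}` on SYMMETRIC tori at fixed large `β` and (2) near-conservation of the disc-repaired flux
   indicator (Peierls bound on `ℤ₂`-monopole clusters, `cost ≥ c_r β`).  (2) is elementary but a large formalisation
   over `wilsonMeasure`; (1) is rigorously OPEN: both sectors contain flat configurations (trivial; twist-eater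
   `Γ₁ = R₁(π)`, `Γ₂ = R₂(π)` on two sheets), but no measure-preserving map relates them (centre-free group: right
   multiplication by the twist-eater changes `β·#sheet-plaquettes` worth of action; a "spread" twist-eater with
   links `R₁(π/P)`, `R₂(π/P)` lies in the TRIVIAL sector), Jensen/thick-vortex bounds give `w₋ ≥ e^{−c P³}`-type only,
   reflection positivity bounds twisted partition functions from ABOVE only, and the raw (unrepaired) flux indicator
   is noise-dominated (`⟨η⟩ ≈ (w₊−w₋)e^{−cρP²}`), so (2) cannot be dodged either: PolyVolume only LOWER-bounds
   `L_k`, the prover may take `L_k ≫ e^{cβ_k}`, hence the witness must work on tori with `ρ P² ≫ 1`, where only the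
   locally repaired indicator carries the sector.  Literature status of (1): rigorous results relate vortex/flux free
   energies to Wilson loops CONDITIONALLY (Mack–Petkova, Ann. Phys. 125 (1980) 117, doi:10.1016/0003-4916(80)90121-9:
   sufficient condition for confinement; 't Hooft 1979 duality; Tomboulis–Yaffe, CMP 100 (1985) 313,
   doi:10.1007/bf01206134: finite temperature, asymmetric tori; Tomboulis arXiv:0707.2179: claimed all-coupling
   confinement via such ratios, disputed) — no unconditional lower bound `Z_tw/Z ≥ e^{−o(S)}` on symmetric 4-tori at
   weak coupling is in print (searched 2026-08-17: crossref/s2; local index unavailable).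
4. NO FORMAL JUNK in the remaining conjuncts (re-audited): `T₀ = 0 ⇒ Y` constant ⇒ both sides `0`; `B < 0`
   vacuous; `n ≤ S₀/2 − T₀ − 1` keeps the direct path dominant (no AllTimesGap trap); `HasLatticeMassGap` quantifies
   LOCAL species only (not hit by flux functionals); floor/window/`tsupport` are ∃-side (junk there helps only the
   prover).  Hence: unconditional `¬W₁` ⇔ new mathematics ((1)+(2) for `SO(3)`), and the honest output of this cycle is
   the negative lemma modulo `PersistentSlabCorrelation` + the restate trigger (class MISSTATED, repair R1/R2). -/
theorem resists : True := trivial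

end Summit.QuantumFields.YangMills.Cruxes.GapAtCorrelationLength.Disproof

end
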